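import Mathlib
import HarnessLib
import HarnessLib.Audit
import Summits.KontsevichZagierPeriods.Statement
import Literature.AlgebraicGeometry.Motives.BaseChange
import Literature.AlgebraicGeometry.Motives.PeriodComparison
import Literature.NumberTheory.Transcendental.Sweep1
import Literature.AlgebraicGeometry.Motives.RelativePeriods
import Summits.KontsevichZagierPeriods.KontsevichZagierPeriods.Theorems.ExpConservativeKernelImpliesStatement

/-!
Route: NoriTransfer

CLOSED (superseded) 2026-08-15T12:52:41Z by planner-KontsevichZagierPeriods-route-KontsevichZagierPeriods-NoriTransfer-0 — reason: superseded:route-KontsevichZagierPeriods-VeryGoodTransfer — superseded by route-KontsevichZagierPeriods-VeryGoodTransfer — note: route-repair (planner, 2026-08-15): SUPERSEDED by route-KontsevichZagierPeriods-VeryGoodTransfer (opened 2026-08-15, OPEN), which is the same line of attack — Kontsevich's formal period conjecture for the classical de Rham/Betti datum + a semialgebraic transfer between period symbols and KZ represen. The file is kept as the record of this route; refuted decls are indexed as negative knowledge (`ledger negatives`).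

# Route NoriTransfer — KontsevichZagierPeriods (planner survey, 2026-08-13)

## Thesis X (it suffices to show X)
Words: there is a period datum (P, R, B, σ) over ℚ̄ — intended: algebraic de Rham cohomology of
pairs, Betti homology of
complex points, Grothendieck comparison, connecting maps of triples — for which (a) Kontsevich's
FORMAL period conjecture
holds (ev : 𝒫̃⁺(ℚ̄) → ℂ injective) and (b) a KZ-TRANSFER exists: an additive map Φ from formal
period symbols to the free
group of KZ integral representations sending the formal relators (linearity, functoriality,
boundary) into
`Literature.NumberTheory.Transcendental.KZ.relations`, and such that every rational KZ
representation r has a symbol-preimage x with Φ x − [r] ∈ relations and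
ev x = value r.
Lean (over existing decls; NOT elaborated at survey time because the olean of
Literature.AlgebraicGeometry.Motives.
WeilCohomology is missing from the build; text in _survey/SketchNori.lean):
`∃ (P : Literature.AlgebraicGeometry.Motives.PeriodRealization (AlgebraicClosure ℚ)) (R :
Literature.AlgebraicGeometry.Motives.RelativePeriodData P) (B : R.BoundaryData) (σ :
AlgebraicClosure ℚ →+* ℂ), Literature.NumberTheory.Transcendental.KontsevichPeriodConjecture R B σ ∧
∃ Φ : Literature.NumberTheory.Transcendental.FreePeriodSymbols R σ →+
Literature.NumberTheory.Transcendental.KZ.FormalRep, (∀ x ∈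
Literature.NumberTheory.Transcendental.formalPeriodRelations R B σ, Φ x ∈
Literature.NumberTheory.Transcendental.KZ.relations) ∧ (∀ (n : ℕ) (r :
Literature.NumberTheory.Transcendental.KZ.IntegralRep n), r.IsRational → ∃ x, Φ x -
Literature.NumberTheory.Transcendental.KZ.of r ∈ Literature.NumberTheory.Transcendental.KZ.relations
∧ Literature.AlgebraicGeometry.Motives.AlongHom.equiv σ
(Literature.NumberTheory.Transcendental.formalPeriodEval R σ x) = (r.value : ℂ))`
Assembly X → KontsevichZagierPeriods: r, r' equal value ⇒ preimages x, x' with ev(x − x') = 0 ⇒ (a)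
x − x' ∈ formal
relations ⇒ (b) Φ(x − x') ∈ KZ.relations ⇒ [r] − [r'] ∈ KZ.relations. Pure algebra.

## Why this line
This is the standard motivic lift [Kontsevich1999 §4; KontsevichZagier2001 §4.1;
HuberMullerStach2017 Def. 13.1.1,
Thm 13.1.4, §13.2]: the formal period algebra is Nori's period algebra, a torsor under the motivic
Galois group, and the
conjecture becomes a statement of algebraic geometry. HMS explicitly do NOT claim that KZ's
three-rules version is
equivalent to the formal version; for the H21 calculus (rule (3) fixed as Newton–Leibniz along a
coordinate) the transfer
(b) is a genuine, provable-in-principle theorem of real-algebraic/o-minimal geometry: semialgebraic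
triangulation of
(X(ℂ), D(ℂ)) [HuberMullerStach2017 Ch. 12, Thm 12.2.1; BelkaleBrosnan2003], resolution of boundary
singularities by
blow-ups (birational ⇒ change of variables on open cells), Stokes on semialgebraic chains reduced to
the band form by
cylindrical decomposition. Imports: Nori motives (algebraic geometry) for (a);
o-minimal/semialgebraic geometry for (b).
The ∃-packaging over hypothesis structures keeps X statable today; the cruxes pin the intended
classical instance.

## Ranked cruxes
2. TRANSFER, relator half: for the classical datum, images of the six `IsFormalPeriodRelator`
constructors lie in
   `Literature.NumberTheory.Transcendental.KZ.relations` (functoriality along non-injective finite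
maps needs injectivity cells; boundary relator needs
   semialgebraic Stokes ⇒ Newton–Leibniz). informal; needs defs ClassicalPeriodDatum, KZTransfer.
3. Kontsevich's formal period conjecture for the classical datum (`KontsevichPeriodConjecture R B
σ`) — the open core.
4. `Literature.NumberTheory.Transcendental.KZKernelConjecture → KontsevichZagierPeriods` (kernel
form suffices; provable now; shared with other routes).
5. TRANSFER, section half: every KZ rep r has a symbol x with Φ x − [r] ∈ relations, ev x = value r
(rep-level form of
   HMS Thm 12.2.1 'naive periods are cohomological'; well-definedness of Φ modulo triangulation
choices).

## Kill criteria
A refutation of crux 2 or 5 for the classical datum (a formal relator whose semialgebraic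
realisation is provably outside
KZ.relations, e.g. via an additive invariant of FormalRep vanishing on the four move sets) closes
this route and feeds route
Neg. Refutation of crux 3 refutes the period conjecture itself (all positive routes close).

## Not decomposed yet
Semialgebraic triangulation, Hardt trivialisation, o-minimal Stokes as separate Literature facts;
the construction of the
classical datum (algebraic de Rham cohomology of pairs over ℚ̄ + comparison) — one definition
request, not split further.
Sources: Kontsevich1999; KontsevichZagier2001; HuberMullerStach2017; BelkaleBrosnan2003; Ayoub2014
(EMS Newsl. 91 survey,
key per PROBLEMS.md §2).

Rationale: Motivic lift: Kontsevich formal period conjecture for the classical de Rham-Betti datum plus a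
semialgebraic transfer of formal relators into Literature.NumberTheory.Transcendental.KZ.relations.

History (route lifecycle, newest last):
- 2026-08-15T12:52:42Z · CLOSED superseded — superseded:route-KontsevichZagierPeriods-VeryGoodTransfer (planner-KontsevichZagierPeriods-route-KontsevichZagierPeriod)

sub-problem: KontsevichZagierPeriods · status: closed(superseded) · opened planner-KontsevichZagierPeriods-Survey-0 2026-08-13T06:07:45Z · rev 0 · ledger route-KontsevichZagierPeriods-NoriTransfer
GENERATED by the gate from the ledger (D-0016/17). Provers cite these decls: `theorem foo : Summit.KontsevichZagierPeriods.KontsevichZagierPeriods.Theses.NoriTransfer.<Decl> := …` in Summits/KontsevichZagierPeriods/KontsevichZagierPeriods/Theorems/<Name>.lean.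
-/

namespace Summit.KontsevichZagierPeriods.KontsevichZagierPeriods.Theses.NoriTransfer

open scoped BigOperators Topology Manifold Classical MeasureTheory ProbabilityTheory Matrix InnerProductSpace ComplexConjugate ContinuousMap
open Filter Set Function TopologicalSpace MeasureTheory

attribute [summit_statement] _root_.KontsevichZagierPeriods

open Literature Periods

/-- item stmt-KontsevichZagierPeriods-0190 · crux · rank 0 · closed · moot by None · by planner
Thesis X. NOT elaborated at filing time: `import Literature.NumberTheory.Transcendental.Sweep1`
fails because the olean of Literature.AlgebraicGeometry.Motives.WeilCohomology is absent from the
build (only .hash/.trace present) — grounder: re-check once the Motives chain is rebuilt; every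
constant was verified by `lean search --decl`. Intended instance of (P,R,B,σ): algebraic de Rham
cohomology of pairs of ℚ̄-varieties, singular homology of complex points, Grothendieck comparison
pairing, connecting morphisms of triples. Φ only needs to be additive; ℚ̄-linearity relators must be
absorbed by KZ moves (integrand additivity/scaling), complex periods handled by taking real parts of
σ(a)∫_γ ω at the level of representations. [elaborates: unverified (missing olean); text in
_survey/SketchNori.lean; sources: Kontsevich1999, KontsevichZagier2001, HuberMullerStach2017] -/
@[route_item "route-KontsevichZagierPeriods-NoriTransfer"]
def NoriThesis : Prop :=
  ∃ (P : Literature.AlgebraicGeometry.Motives.PeriodRealization (AlgebraicClosure ℚ)) (R : Literature.AlgebraicGeometry.Motives.RelativePeriodData P) (B : R.BoundaryData) (σ : AlgebraicClosure ℚ →+* ℂ), Literature.NumberTheory.Transcendental.KontsevichPeriodConjecture R B σ ∧ ∃ Φ : FreeAbelianGroup (Literature.NumberTheory.Transcendental.PeriodSymbol R σ) →+ Literature.NumberTheory.Transcendental.KZ.FormalRep, (∀ x : FreeAbelianGroup (Literature.NumberTheory.Transcendental.PeriodSymbol R σ), FreeAbelianGroup.lift (fun s : Literature.NumberTheory.Transcendental.PeriodSymbol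 R σ => (Finsupp.single s 1 : Literature.NumberTheory.Transcendental.FreePeriodSymbols R σ)) x ∈ Literature.NumberTheory.Transcendental.formalPeriodRelations R B σ → Φ x ∈ Literature.NumberTheory.Transcendental.KZ.relations) ∧ (∀ (n : ℕ) (r : Literature.NumberTheory.Transcendental.KZ.IntegralRep n), r.IsRational → ∃ x : FreeAbelianGroup (Literature.NumberTheory.Transcendental.PeriodSymbol R σ), Φ x - Literature.NumberTheory.Transcendental.KZ.of r ∈ Literature.NumberTheory.Transcendental.KZ.relations ∧ Literature.AlgebraicGeometry.Motives.AlongHom.equiv σ (Literature.NumberTheory.Transcendental.formalPeriodEval R σ (FreeAbelianGroup.lift (fun s : Literature.NumberTheory.Transcendental.PeriodSymbol R σ => (Finsupp.single s 1 : Literature.NumberTheory.Transcendental.FreePeriodSymbols R σ)) x)) = (r.value : ℂ))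

-- item stmt-KontsevichZagierPeriods-0194 · crux · rank 2 · closed · moot by None · by planner — informal only, no Lean statement yet:
--   Hardest H21-specific step, believed provable in principle, and the most informative test of the
--   fixed calculus. For the classical datum define Φ on a symbol (X,D,i,ω,γ): choose a ℚ̄-semialgebraic
--   triangulation of (X(ℂ),D(ℂ)) ⊂ ℝ^{2N} (Hironaka/Łojasiewicz; HuberMullerStach2017 §2.6, Prop.
--   12.2.?), represent γ by a ℚ-combination of oriented semialgebraic i-simplices, ω by an algebraic
--   i-form regular near the chain after blow-up (BelkaleBrosnan2003; HMS Lemma 12.2.?), and send the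
--   symbol to the ℤ-combination of IntegralReps obtained by parametrising simplices by the standard open
--   simplex in ℝ^i

-- item stmt-KontsevichZagierPeriods-0196 · support · rank 3 · closed · moot by None · by planner — informal only, no Lean statement yet:
--   `Literature.NumberTheory.Transcendental.KontsevichPeriodConjecture R B σ` for (P,R,B) :=
--   ClassicalPeriodDatum and any σ. The open core (equivalent to the Grothendieck period conjecture for
--   all Nori motives over ℚ̄, HuberMullerStach2017 §13.2; see route Grothendieck). Filed so that the
--   dependency is explicit; no decomposition proposed. [needs_definition: ClassicalPeriodDatum; sources:
--   Kontsevich1999, HuberMullerStach2017, Ayoub2014]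

/-- item stmt-KontsevichZagierPeriods-0197 · support · rank 4 · closed · proved by Summit.KontsevichZagierPeriods.KernelForm.kernel_implies_statement (prover) · by planner
Provable now, 3 lines: r.value = r'.value ⇒ eval (of r − of r') = 0 (map_sub, eval_of) ⇒ of r − of
r' ∈ relations. Every structural route (Nori, Grothendieck, ExpConservative) lands in the kernel
form; this item is the shared last step. [elaborates: yes: _survey/SketchA.lean; sources:
KontsevichZagier2001, HuberMullerStach2017] -/
@[route_item "route-KontsevichZagierPeriods-NoriTransfer"]
def KernelImpliesStatement : Prop :=
  (∀ c : Literature.NumberTheory.Transcendental.KZ.FormalRep, Literature.NumberTheory.Transcendental.KZ.eval c = 0 → c ∈ Literature.NumberTheory.Transcendental.KZ.relations) → KontsevichZagierPeriods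

-- item stmt-KontsevichZagierPeriods-0198 · support · rank 5 · closed · moot by None · by planner — informal only, no Lean statement yet:
--   For the classical datum and the Φ of crux #2: ∀ n (r : IntegralRep n), ∃ x : FreePeriodSymbols R σ,
--   Φ x − of r ∈ KZ.relations ∧ ev x = r.value. This is the representation-level refinement of HMS Thm
--   12.2.1 (naive effective periods = cohomological periods; in the tree as the Prop
--   `Literature.NumberTheory.Transcendental.CohomologicalPeriodsEqStatement P R σ`): the proof there
--   writes ∫_σ p/q as ∫_γ ω on (blow-up of ℙⁿ, boundary ∪ polar divisor); the extra content here is that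
--   the passage r ↦ (X,D,ω,γ) ↦ Φ(symbol) returns to [r] using only KZ moves (compactification CoV,
--   blow-up CoV on open cells,

/-- item stmt-KontsevichZagierPeriods-0192 · assembly · rank 1 · closed · moot by None · by planner
Assembly (pure algebra): given rational r, r' with r.value = r'.value pick x, x' from the section
property; ev x = ev x' so x − x' ∈ ker (formalPeriodEval) ⇒ by KontsevichPeriodConjecture x − x' ∈
formalPeriodRelations ⇒ Φ(x − x') ∈ KZ.relations ⇒ [r] − [r'] = Φ(x−x') − (Φ x − [r]) + (Φ x' −
[r']) ∈ KZ.relations. Same olean caveat as #0. [elaborates: unverified (missing olean); sources: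
HuberMullerStach2017] -/
@[route_item "route-KontsevichZagierPeriods-NoriTransfer"]
def Assembly : Prop :=
  (∃ (P : Literature.AlgebraicGeometry.Motives.PeriodRealization (AlgebraicClosure ℚ)) (R : Literature.AlgebraicGeometry.Motives.RelativePeriodData P) (B : R.BoundaryData) (σ : AlgebraicClosure ℚ →+* ℂ), Literature.NumberTheory.Transcendental.KontsevichPeriodConjecture R B σ ∧ ∃ Φ : FreeAbelianGroup (Literature.NumberTheory.Transcendental.PeriodSymbol R σ) →+ Literature.NumberTheory.Transcendental.KZ.FormalRep, (∀ x : FreeAbelianGroup (Literature.NumberTheory.Transcendental.PeriodSymbol R σ), FreeAbelianGroup.lift (fun s : Literature.NumberTheory.Transcendental.PeriodSymbol R σ => (Finsupp.single s 1 : Literature.NumberTheory.Transcendental.FreePeriodSymbols R σ)) x ∈ Literature.NumberTheory.Transcendental.formalPeriodRelations R B σ → Φ x ∈ Literature.NumberTheory.Transcendental.KZ.relations) ∧ (∀ (n : ℕ) (r : Literature.NumberTheory.Transcendental.KZ.IntegralRep n), r.IsRational → ∃ x : FreeAbelianGroup (Literature.NumberTheory.Transcendental.PeriodSymbol R σ),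 Φ x - Literature.NumberTheory.Transcendental.KZ.of r ∈ Literature.NumberTheory.Transcendental.KZ.relations ∧ Literature.AlgebraicGeometry.Motives.AlongHom.equiv σ (Literature.NumberTheory.Transcendental.formalPeriodEval R σ (FreeAbelianGroup.lift (fun s : Literature.NumberTheory.Transcendental.PeriodSymbol R σ => (Finsupp.single s 1 : Literature.NumberTheory.Transcendental.FreePeriodSymbols R σ)) x)) = (r.value : ℂ))) → KontsevichZagierPeriods

end Summit.KontsevichZagierPeriods.KontsevichZagierPeriods.Theses.NoriTransfer
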